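/-
Origin: expansion seat `planner-pub-hodgecm-mc-period-1-g14-0`, handover #P48a 2026-08-20T10:12Z md5 6c0288229cbd3a574fe66e44bc32d353 (361 l., 13 decls; NEW additive drop-alone leaf; imports INSTALLED HodgeCM.Model.ArchLineSlotTypeArch (RUN 43, #1214) + HodgeCM.Vendored.H21.NumberTheory.Weil1964.AdelicMetaplecticFiniteImplementer (RUN 35) only; rowdeps none, no RUN-47 import; ns HodgeCM.Model.ArchSideTerm; 0 proof-hole, 0 set_option maxHeartbeats, no records/Prop-defs/cites-as-hypotheses; cert lean-direct vs PKG oleans of record rc 0 / 0 warn wall 24 s certs/axioms-strip48.log 12/12 trio 0 proof-holeAx; homonyms 0 vs PKG + theta-3/binder-1/sinst-1 stage48; (J-mu) slots 2/3 input (STRIP) for the CONJUGATED plane = sinst #1217 socket hstrip + binder-1 (htau) pure-tensor form + the M/hM/A/Mf/hAM inputs of sinst #1221) NAME LIST: HodgeCM.Model.ArchSideTerm.exists_cmConjLineTensorFin_tmul_eq_tmul . HodgeCM.Model.ArchSideTerm.exists_cmConjLineTensorFin_testFun_eq_tmul . HodgeCM.Model.ArchSideTerm.cmConjLineTensorFin_eq_reindex_omega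 (`HOME/mc/pub-hodgecm-mc-period-1-g14/stage48/HodgeCM/Model/ArchConjSlotStrip.lean`, md5 6c0288229cbd, 361 lines);
landed by the second packager p2 gen 6 (p2-g6) in gate run 48 as `HodgeCM/Model/ArchConjSlotStrip.lean` (verbatim).
-/
/-
Origin: speedrun cell pub-hodgecm, MODEL-CONSTRUCTION sub-cell, lineage mc-period-1 (PERIOD LANE construction prover),
seat planner-pub-hodgecm-mc-period-1-g14-0 (gen 14), 2026-08-20.  Target in PKG: `HodgeCM/Model/ArchConjSlotStrip.lean`
(NEW additive drop-alone leaf; RUN 48 material, row #P48a; imports RUN-43 `Model/ArchLineSlotTypeArch` (sinst-1 #1214) + the vendored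
W2-⊗ stripping files `AdelicMetaplecticTensorStripping` / `AdelicMetaplecticFiniteImplementer`).
KERNEL only: 0 records / `def … : Prop` / cites, 0 proof holes; intended closure {propext, Classical.choice, Quot.sound}.
-/
import Summits.HodgeConjecture.HodgeCM.Model.ArchLineSlotTypeArch
import Literature.NumberTheory.Weil1964.AdelicMetaplecticFiniteImplementer

/-!
# (J-μ) SLOTS 2/3, INPUT (STRIP): the conjugated see-saw tensor of two test functions is a pure tensor

Socket: sinst-1's `slotTypeVec_sub_eq_of_conj_transport` (`Model/ArchLineSlotTypeConjArch`, RUN 46) reads the slot types of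
the CONJUGATED plane `isoGL · diag(a₂,a₃) · isoGL⁻¹` off an eigen-identity, given
(STRIP) `hstrip : φ_N(Φ₀) ⊗‴ φ_N(Φ₁) = E (Y ⊗ F)` for the conjugated see-saw tensor `⊗‴ = cmConjLineTensorFin` and
(VT) an identification of `Y`.  #1214 did (STRIP) for the UNconjugated plane, where the see-saw element is `1`
(`cmSeesawElement_eq_one`).  Here the see-saw element `h₀ = r(g₀ ⊗ 1, C)` is a genuine rational symplectic element and
`⊗‴ = R_e ∘ ω(r_F h₀) ∘ R_f⁻¹ ∘ ⊠`; the Weil operator `ω(r_F h₀)` is STRIPPED by the W2-⊗ theorem of the vendored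
`AdelicMetaplecticTensorStripping` / `AdelicMetaplecticFiniteImplementer` (their `exists_finImplementer`,
`exists_continuousLinearEquiv_map_tmul_of_mem_adelicMpCont`: `ω(p) = A_∞ ⊗ M_f` on pure tensors, `A_∞` a topological
automorphism of `𝓢((L⁺ ⊗ ℝ)^{3×2})`; the operator form of Weil's `𝐫_𝐀 = ⊗_v 𝐫_v`, as cited there):
* §1 `exists_omega_map_tmul_of_isUnit_det` — for ANY `p ∈ Mp_ψ(W_𝔸)ᶜᵒⁿᵗ` over a Gram matrix with unit determinant:
  `∃ A_∞ M_f, ω(p) (E(Φ ⊗ f)) = E(A_∞ Φ ⊗ M_f f)` with `1 ⊗ M_f` implementing `π p` on the finite Heisenberg elements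
  (the `hAM` / `hMf` hypothesis shapes of `ArchSchrodingerFollandDictionary.arch_covariant_of_implements`,
  `AdelicMetaplecticTensorStripping.eq_adelicTensorEnd_archPart_of_mem_adelicMp`);
* §2 `cmConjSeesawMp` — the element `r_F h₀ ∈ Mp_ψ(W_𝔸)ᶜᵒⁿᵗ` of the conjugated CM plane, NAMED (the `p` inside
  `cmConjLineTensor`), `proj_cmConjSeesawMp` (`π (r_F h₀) = h₀`), and **`cmConjLineTensorFin_eq_reindex_omega`**:
  `φ₀ ⊗‴ φ₁ = R_e (ω(r_F h₀) (R_f⁻¹ (R_{e₁}⁻¹ φ₀ ⊠ R_{e₁}⁻¹ φ₁)))` (`rfl`-level unfolding);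
* §3 **`exists_cmConjLineTensorFin_testFun_eq_tmul`** — (STRIP) at a see-saw datum `S`: there are `A_∞`, `M_f` as in §1 for
  `r_F h₀` such that for all `Φ₀ Φ₁ x₀ x₁ N`, `φ_N(Φ₀) ⊗‴ φ_N(Φ₁) = E (R_e^∞ (A_∞ (conjSlotRawBox Φ₀ Φ₁)) ⊗ f)` for some
  finite `f`, where `conjSlotRawBox Φ₀ Φ₁ = (R_f^∞)⁻¹ ((R_{e₁}^∞)⁻¹ Φ₀ ⊠_∞ (R_{e₁}^∞)⁻¹ Φ₁)` is #1214's box before the last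
  reindex (`slotArchBox = R_e^∞ ∘ conjSlotRawBox`, `slotArchBox_eq`).  The archimedean factor `Y` of the socket is thus
  `R_e^∞ (A_∞ (conjSlotRawBox Φ₀ Φ₁))`; its identification (VT) is the archimedean comparison of `A_∞` with
  `ω_∞(1,k) ∘ (Levi model operator)` (period-1 note STRIP-SCOPE.g14 §2), not done here.
Nothing here is a claim of PerL/QW8; kernel analysis over the tree's constructed objects.
-/

set_option autoImplicit false

noncomputable section

open scoped Matrix Kronecker Classical SchwartzMap TensorProduct
open NumberField.mixedEmbedding (mixedSpace)
open Literature.RepresentationTheory.HeisenbergGroup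
open Literature.NumberTheory.Automorphic Literature.NumberTheory.Automorphic.UnitaryGroup Literature.NumberTheory.Weil1964
open Literature.NumberTheory.GelbartRogawski1991 Literature.NumberTheory.GelbartRogawski1991.UnitaryDualPair
open HodgeCM.Adelic HodgeCM.PerL34 HodgeCM.PerL34.TorusEmbedding

namespace HodgeCM.Model.ArchSideTerm

/-! ## § 1 stripping `ω(p)` for any `p ∈ Mp_ψ(W_𝔸)ᶜᵒⁿᵗ` over a Gram matrix with unit determinant -/

section Strip

variable {F : Type} [Field F] [NumberField F] {ι : Type} [Fintype ι] [DecidableEq ι]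
  {T : Matrix ι ι (NumberField.AdeleRing (NumberField.RingOfIntegers F) F)}

/-- the first component of `p` read through `Mp_ψ(W_𝔸)ᶜᵒⁿᵗ` is `π p` (bookkeeping for the `hMf` clause of § 1). -/
theorem coe_adelicMp_fst_eq_proj (p : adelicMpCont F ι T) :
    (p.1 : symplecticGroup (polar (adelicForm F ι T)) × (piSchwartzBruhat F ι ≃ₗ[ℂ] piSchwartzBruhat F ι)).1 =
      adelicMpCont.proj F ι T p :=
  rfl

/-- `ω(p)` IS the second component (bookkeeping: the `M` of `arch_covariant_of_implements` is `(p : Sp × ≃).2`). -/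
theorem adelicMpCont_omega_apply_eq (p : adelicMpCont F ι T) (X : piSchwartzBruhat F ι) :
    adelicMpCont.omega F ι T p X =
      (p.1 : symplecticGroup (polar (adelicForm F ι T)) × (piSchwartzBruhat F ι ≃ₗ[ℂ] piSchwartzBruhat F ι)).2 X := by
  rw [adelicMpCont.omega_apply, omegaPsi_apply]

/-- **STRIP**: `ω(p) (E(Φ ⊗ f)) = E(A_∞ Φ ⊗ M_f f)` with `A_∞` a topological automorphism of the archimedean Schwartz space and
`1 ⊗ M_f` implementing `π p` on the finite Heisenberg elements (Weil's `𝐫_𝐀 = ⊗_v 𝐫_v`, W2-⊗ of the cell). -/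
theorem exists_omega_map_tmul_of_isUnit_det (hT : IsUnit T.det) (p : adelicMpCont F ι T) :
    ∃ (A : 𝓢((ι → mixedSpace F), ℂ) ≃L[ℂ] 𝓢((ι → mixedSpace F), ℂ)) (Mf : FinSB F ι ≃ₗ[ℂ] FinSB F ι),
      (∀ h ∈ finHeisenberg T, ∀ Φ : piSchwartzBruhat F ι,
        adelicTensorEnd LinearMap.id (Mf : FinSB F ι →ₗ[ℂ] FinSB F ι) (adelicSchrodinger F ι T h Φ) =
          adelicSchrodinger F ι T
            ((ofSymplectic (polar (adelicForm F ι T)) (adelicMpCont.proj F ι T p)).act h)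
            (adelicTensorEnd LinearMap.id (Mf : FinSB F ι →ₗ[ℂ] FinSB F ι) Φ)) ∧
      ∀ (Φ : 𝓢((ι → mixedSpace F), ℂ)) (f : FinSB F ι),
        adelicMpCont.omega F ι T p (piSchwartzBruhatEquiv F ι (Φ ⊗ₜ f)) = piSchwartzBruhatEquiv F ι (A Φ ⊗ₜ Mf f) := by
  -- `have` before `obtain`: destructuring a non-variable makes `obtain` generalize it over (= re-check) the goal
  have hM := exists_finImplementer (mulVec_surjective_of_isUnit_det' F ι T hT) p.1
  obtain ⟨Mf, hMf⟩ := hM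
  have hA' := exists_continuousLinearEquiv_map_tmul_of_mem_adelicMpCont (mulVec_surjective_of_isUnit_det' F ι T hT)
    p.1 p.2 Mf hMf
  obtain ⟨A, hA⟩ := hA'
  refine ⟨A, Mf, hMf, fun Φ f => ?_⟩
  rw [adelicMpCont_omega_apply_eq]
  exact (hA Φ f).1

end Strip

/-! ## § 2 the metaplectic element `r_F h₀` of the conjugated CM plane, named -/

section ConjPlane

variable (L : Type) [Field L] [NumberField L] [NumberField.IsCMField L] {N n n₁ : ℕ}
  (e : Fin N × Fin 2 ≃ Fin n) (e₁' : Fin N × Fin 1 ≃ Fin n₁)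
variable (dV : Fin N → L) (hdV : ∀ i, NumberField.IsCMField.complexConj L (dV i) = dV i) (hdV0 : ∀ i, dV i ≠ 0)
variable (a : Fin 2 → L) (ha : ∀ i, NumberField.IsCMField.complexConj L (a i) = a i) (ha0 : ∀ i, a i ≠ 0)
variable (b : Fin 2 → L) (hb : ∀ i, NumberField.IsCMField.complexConj L (b i) = b i) (hb0 : ∀ i, b i ≠ 0) (g₀ : GL (Fin 2) L)
  (hg₀ : ((g₀ : Matrix (Fin 2) (Fin 2) L).map (NumberField.IsCMField.complexConj L : L →+* L))ᵀ * Matrix.diagonal a *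
    (g₀ : Matrix (Fin 2) (Fin 2) L) = Matrix.diagonal b)

/-- the adelic Gram matrix `T_V ⊗ T_W` of the big pair in the PRODUCT currency `Fin N × Fin (1 + 1)` — typed LITERALLY as the `T`
inside `cmConjLineTensor`'s `ω` (see-saw ranks `M₁ = M₂ = 1`; the index is `Fin (1 + 1)`, not `Fin 2`, on purpose: one currency, no
silent `1 + 1 = 2` conversions in the types below). -/
abbrev cmProdGram : Matrix (Fin N × Fin (1 + 1)) (Fin N × Fin (1 + 1))
    (NumberField.AdeleRing (NumberField.RingOfIntegers (↥(NumberField.maximalRealSubfield L))) (↥(NumberField.maximalRealSubfield L))) :=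
  (realDiagonal L dV hdV).map
      (algebraMap (↥(NumberField.maximalRealSubfield L))
        (NumberField.AdeleRing (NumberField.RingOfIntegers (↥(NumberField.maximalRealSubfield L))) (↥(NumberField.maximalRealSubfield L)))) ⊗ₖ
    Matrix.map (m := Fin (1 + 1)) (n := Fin (1 + 1)) (realDiagonal L a ha)
      (algebraMap (↥(NumberField.maximalRealSubfield L))
        (NumberField.AdeleRing (NumberField.RingOfIntegers (↥(NumberField.maximalRealSubfield L))) (↥(NumberField.maximalRealSubfield L))))

include hdV0 ha0 in
/-- `det (T_V ⊗ T_W)` is a unit (the `hT` of `cmConjLineTensor`). -/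
theorem isUnit_det_cmProdGram : IsUnit (cmProdGram L dV hdV a ha).det :=
  (Matrix.isUnit_iff_isUnit_det _).1
    (isUnit_kronecker_map (↥(NumberField.maximalRealSubfield L)) N (isUnit_det_realDiagonal L dV hdV hdV0)
      (isUnit_det_realDiagonal L a ha ha0))

/-- **`r_F h₀ ∈ Mp_ψ(W_𝔸)ᶜᵒⁿᵗ`** — the rational-points lift (`ratPointsThetaLiftCont`) of the see-saw element `h₀` of the conjugated
CM plane (`seesawElement` of the rational isometry `g₀ = isoGL` and the Gram intertwiner of `gramIntertwiner_conj`): by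
definition the element whose `ω` appears inside `cmConjLineTensor`. -/
def cmConjSeesawMp : adelicMpCont (↥(NumberField.maximalRealSubfield L)) (Fin N × Fin (1 + 1)) (cmProdGram L dV hdV a ha) :=
  -- spelled so that unfolding this definition lands, up to unfolding the abbreviation `cmProdGram`, SYNTACTICALLY on the
  -- operator inside `seesawConjTensor_apply` (same `hT` term as `cmConjLineTensor`); `T` is given explicitly (not `_`):
  -- with a metavariable there Lean unifies `Mp_ψ(W_𝔸)ᶜᵒⁿᵗ`-types by unfolding the subgroups (minutes of `whnf`)
  ratPointsThetaLiftCont (↥(NumberField.maximalRealSubfield L)) (Fin N × Fin (1 + 1)) (cmProdGram L dV hdV a ha)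
    ((Matrix.isUnit_iff_isUnit_det _).1
      (isUnit_kronecker_map (↥(NumberField.maximalRealSubfield L)) N (isUnit_det_realDiagonal L dV hdV hdV0)
        (isUnit_det_realDiagonal L a ha ha0)))
    ⟨seesawElement (↥(NumberField.maximalRealSubfield L)) L (NumberField.IsCMField.complexConj L) N 1 1 (Matrix.diagonal dV)
        (Matrix.diagonal a) (Matrix.diagonal (lineVec L (b 0))) (Matrix.diagonal (lineVec L (b 1)))
        (complexConj_imagUnit L) (imagUnit_ne_zero L) (imagUnit_mul_self L)
        (realDiagonal_isSymm L dV hdV) (realDiagonal_isSymm L a ha)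
        (realDiagonal_isSymm L (lineVec L (b 0)) fun _ => hb 0) (realDiagonal_isSymm L (lineVec L (b 1)) fun _ => hb 1)
        (realDiagonal_map L dV hdV).symm (realDiagonal_map L a ha).symm
        (realDiagonal_map L (lineVec L (b 0)) fun _ => hb 0).symm (realDiagonal_map L (lineVec L (b 1)) fun _ => hb 1).symm
        (adelicIsometry_conj L a b g₀ hg₀) (gramIntertwiner_conj L a ha ha0 b hb hb0 (realDiagonal L dV hdV)),
      seesawElement_mem_range (↥(NumberField.maximalRealSubfield L)) L (NumberField.IsCMField.complexConj L) N 1 1 (Matrix.diagonal dV)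
        (Matrix.diagonal a) (Matrix.diagonal (lineVec L (b 0))) (Matrix.diagonal (lineVec L (b 1)))
        (complexConj_imagUnit L) (imagUnit_ne_zero L) (imagUnit_mul_self L)
        (realDiagonal_isSymm L dV hdV) (realDiagonal_isSymm L a ha)
        (realDiagonal_isSymm L (lineVec L (b 0)) fun _ => hb 0) (realDiagonal_isSymm L (lineVec L (b 1)) fun _ => hb 1)
        (isUnit_det_realDiagonal L dV hdV hdV0) (isUnit_det_realDiagonal L a ha ha0)
        ((Matrix.isUnit_iff_isUnit_det _).1
          (isUnit_kronecker_map (↥(NumberField.maximalRealSubfield L)) N (isUnit_det_realDiagonal L dV hdV hdV0)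
            (isUnit_det_realDiagonal L a ha ha0)))
        (realDiagonal_map L dV hdV).symm (realDiagonal_map L a ha).symm
        (realDiagonal_map L (lineVec L (b 0)) fun _ => hb 0).symm (realDiagonal_map L (lineVec L (b 1)) fun _ => hb 1).symm
        (Literature.NumberTheory.Automorphic.val_toAdeleGL L g₀) (adelicIsometry_conj L a b g₀ hg₀)
        (coe_gramConj L a ha ha0 b hb hb0) (gramIntertwiner_conj L a ha ha0 b hb hb0 (realDiagonal L dV hdV))⟩

/-- **`π (r_F h₀) = h₀`**: the symplectic component of `cmConjSeesawMp` is the see-saw element. -/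
theorem proj_cmConjSeesawMp :
    adelicMpCont.proj (↥(NumberField.maximalRealSubfield L)) (Fin N × Fin (1 + 1)) (cmProdGram L dV hdV a ha)
        (cmConjSeesawMp L dV hdV hdV0 a ha ha0 b hb hb0 g₀ hg₀) =
      (seesawElement (↥(NumberField.maximalRealSubfield L)) L (NumberField.IsCMField.complexConj L) N 1 1 (Matrix.diagonal dV)
        (Matrix.diagonal a) (Matrix.diagonal (lineVec L (b 0))) (Matrix.diagonal (lineVec L (b 1)))
        (complexConj_imagUnit L) (imagUnit_ne_zero L) (imagUnit_mul_self L)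
        (realDiagonal_isSymm L dV hdV) (realDiagonal_isSymm L a ha)
        (realDiagonal_isSymm L (lineVec L (b 0)) fun _ => hb 0) (realDiagonal_isSymm L (lineVec L (b 1)) fun _ => hb 1)
        (realDiagonal_map L dV hdV).symm (realDiagonal_map L a ha).symm
        (realDiagonal_map L (lineVec L (b 0)) fun _ => hb 0).symm (realDiagonal_map L (lineVec L (b 1)) fun _ => hb 1).symm
        (adelicIsometry_conj L a b g₀ hg₀) (gramIntertwiner_conj L a ha ha0 b hb hb0 (realDiagonal L dV hdV)) :) :=
  -- `( … :)`: elaborated WITHOUT the expected type — propagating it into `seesawElement` before its implicit Gram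
  -- matrices are known makes the unifier compare `Sp(W_𝔸)`-subtypes by unfolding (10 s);
  -- the three type-level arguments explicit: as metavariables they send the unifier through the subgroups (slow)
  proj_ratPointsThetaLiftCont (↥(NumberField.maximalRealSubfield L)) (Fin N × Fin (1 + 1)) (cmProdGram L dV hdV a ha) _ _

/-- **`φ₀ ⊗‴ φ₁ = R_e (ω(r_F h₀) (R_f⁻¹ (R_{e₁}⁻¹ φ₀ ⊠ R_{e₁}⁻¹ φ₁)))`** (`f = finProdSumEquiv N 1 1`): the conjugated see-saw tensor,
unfolded down to the ONE Weil operator `ω(cmConjSeesawMp)`. -/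
theorem cmConjLineTensorFin_eq_reindex_omega (φ₀ φ₁ : piSchwartzBruhat (↥(NumberField.maximalRealSubfield L)) (Fin n₁)) :
    cmConjLineTensorFin L e e₁' dV hdV hdV0 a ha ha0 b hb hb0 g₀ hg₀ φ₀ φ₁ =
      piSBReindex (↥(NumberField.maximalRealSubfield L)) e
        (adelicMpCont.omega (↥(NumberField.maximalRealSubfield L)) (Fin N × Fin (1 + 1)) (cmProdGram L dV hdV a ha)
          (cmConjSeesawMp L dV hdV hdV0 a ha ha0 b hb hb0 g₀ hg₀)
          ((piSBReindex (↥(NumberField.maximalRealSubfield L)) (finProdSumEquiv N 1 1)).symm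
            (tensorToSum (↥(NumberField.maximalRealSubfield L)) (Fin N × Fin 1) (Fin N × Fin 1)
              ((piSBReindex (↥(NumberField.maximalRealSubfield L)) e₁').symm φ₀)
              ((piSBReindex (↥(NumberField.maximalRealSubfield L)) e₁').symm φ₁)))) :=
  -- term-mode on purpose: `rw [cmConjLineTensorFin_apply, …]` on a goal carrying `r_F h₀` costs minutes of `kabstract` refutations
  (cmConjLineTensorFin_apply L e e₁' dV hdV hdV0 a ha ha0 b hb hb0 g₀ hg₀ φ₀ φ₁).trans
    (seesawConjTensor_apply (↥(NumberField.maximalRealSubfield L)) L (NumberField.IsCMField.complexConj L) N 1 1 e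
      (Matrix.diagonal dV) (Matrix.diagonal a) (Matrix.diagonal (lineVec L (b 0))) (Matrix.diagonal (lineVec L (b 1)))
      (complexConj_imagUnit L) (imagUnit_ne_zero L) (imagUnit_mul_self L)
      (realDiagonal_isSymm L dV hdV) (realDiagonal_isSymm L a ha)
      (realDiagonal_isSymm L (lineVec L (b 0)) fun _ => hb 0) (realDiagonal_isSymm L (lineVec L (b 1)) fun _ => hb 1)
      (isUnit_det_realDiagonal L dV hdV hdV0) (isUnit_det_realDiagonal L a ha ha0)
      ((Matrix.isUnit_iff_isUnit_det _).1
        (isUnit_kronecker_map (↥(NumberField.maximalRealSubfield L)) N (isUnit_det_realDiagonal L dV hdV hdV0)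
          (isUnit_det_realDiagonal L a ha ha0)))
      (realDiagonal_map L dV hdV).symm (realDiagonal_map L a ha).symm
      (realDiagonal_map L (lineVec L (b 0)) fun _ => hb 0).symm (realDiagonal_map L (lineVec L (b 1)) fun _ => hb 1).symm
      (Literature.NumberTheory.Automorphic.val_toAdeleGL L g₀) (adelicIsometry_conj L a b g₀ hg₀)
      (coe_gramConj L a ha ha0 b hb hb0) (gramIntertwiner_conj L a ha ha0 b hb hb0 (realDiagonal L dV hdV)) _ _)

end ConjPlane

/-! ## § 3 (STRIP) at a see-saw datum -/

section Datum

variable {L : CMField} {ι₁ : L →+* ℂ} (V : HermSpace3 L ι₁) (S : StubTree.SeesawDatum L)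

/-- **the raw archimedean box of two slot functions** `(R_f^∞)⁻¹ ((R_{e₁}^∞)⁻¹ Φ₀ ⊠_∞ (R_{e₁}^∞)⁻¹ Φ₁)` in the PRODUCT currency
`Fin 3 × Fin (1 + 1)` — #1214's `slotArchBox` before its last reindex `R_e^∞` (`slotArchBox_eq`); the vector `A_∞` acts on. -/
def conjSlotRawBox (Φ₀ Φ₁ : 𝓢((Fin 3 → mixedSpace (↥(NumberField.maximalRealSubfield (L : Type)))), ℂ)) :
    𝓢((Fin 3 × Fin (1 + 1) → mixedSpace (↥(NumberField.maximalRealSubfield (L : Type)))), ℂ) :=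
  schwartzReindexCLM (↥(NumberField.maximalRealSubfield (L : Type))) (finProdSumEquiv 3 1 1).symm
    (archBoxTensor (schwartzReindexCLM (↥(NumberField.maximalRealSubfield (L : Type))) e₁.symm Φ₀)
      (schwartzReindexCLM (↥(NumberField.maximalRealSubfield (L : Type))) e₁.symm Φ₁))

/-- `slotArchBox Φ₀ Φ₁ = R_e^∞ (conjSlotRawBox Φ₀ Φ₁)`. -/
theorem slotArchBox_eq (Φ₀ Φ₁ : 𝓢((Fin 3 → mixedSpace (↥(NumberField.maximalRealSubfield (L : Type)))), ℂ)) :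
    slotArchBox (L := L) Φ₀ Φ₁ = schwartzReindexCLM (↥(NumberField.maximalRealSubfield (L : Type))) finProdFinEquiv (conjSlotRawBox (L := L) Φ₀ Φ₁) :=
  rfl

/-- the finite companion of `conjSlotRawBox`: `(R_f)⁻¹ (finSum (R_{e₁}⁻¹ f₀ ⊗ R_{e₁}⁻¹ f₁))` (the finite part of the two slots
before `ω(r_F h₀)`; `f = finProdSumEquiv 3 1 1`). -/
def conjSlotRawFin (f₀ f₁ : FinSB (↥(NumberField.maximalRealSubfield (L : Type))) (Fin 3)) : FinSB (↥(NumberField.maximalRealSubfield (L : Type))) (Fin 3 × Fin (1 + 1)) :=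
  finSBReindex (↥(NumberField.maximalRealSubfield (L : Type))) (finProdSumEquiv 3 1 1).symm
    (finSumEquiv (↥(NumberField.maximalRealSubfield (L : Type))) (Fin 3 × Fin 1) (Fin 3 × Fin 1)
      (finSBReindex (↥(NumberField.maximalRealSubfield (L : Type))) e₁.symm f₀ ⊗ₜ finSBReindex (↥(NumberField.maximalRealSubfield (L : Type))) e₁.symm f₁))

/-- **(STRIP) FOR THE CONJUGATED PLANE, pure-tensor form.**  There are a topological automorphism `A_∞` of
`𝓢((L⁺ ⊗ ℝ)^{3×2})` and a linear automorphism `M_f` of the finite Schwartz–Bruhat space with `ω(r_F h₀) = A_∞ ⊗ M_f` on pure tensors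
(`1 ⊗ M_f` implementing `h₀` on the finite Heisenberg elements), such that the conjugated see-saw tensor of two PURE tensors is the
pure tensor `E (R_e^∞ (A_∞ (conjSlotRawBox Φ₀ Φ₁)) ⊗ R_e^f (M_f (conjSlotRawFin f₀ f₁)))` — binder-1's `(htau)` shape
`τ (E(Φ₀ ⊗ f₀)) (E(Φ₁ ⊗ f₁)) = E (T_∞ Φ₀ Φ₁ ⊗ T_f f₀ f₁)` with `T_∞`, `T_f` read off. -/
theorem exists_cmConjLineTensorFin_tmul_eq_tmul :
    ∃ (A : 𝓢((Fin 3 × Fin (1 + 1) → mixedSpace (↥(NumberField.maximalRealSubfield (L : Type)))), ℂ) ≃L[ℂ]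
        𝓢((Fin 3 × Fin (1 + 1) → mixedSpace (↥(NumberField.maximalRealSubfield (L : Type)))), ℂ))
      (Mf : FinSB (↥(NumberField.maximalRealSubfield (L : Type))) (Fin 3 × Fin (1 + 1)) ≃ₗ[ℂ]
        FinSB (↥(NumberField.maximalRealSubfield (L : Type))) (Fin 3 × Fin (1 + 1))),
      (∀ h ∈ finHeisenberg (cmProdGram (L : Type) (frameD V) (frameD_real V) (dW S) (dW_real S)),
        ∀ Φ : piSchwartzBruhat (↥(NumberField.maximalRealSubfield (L : Type))) (Fin 3 × Fin (1 + 1)),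
        adelicTensorEnd LinearMap.id (Mf : _ →ₗ[ℂ] _)
            (adelicSchrodinger (↥(NumberField.maximalRealSubfield (L : Type))) (Fin 3 × Fin (1 + 1))
              (cmProdGram (L : Type) (frameD V) (frameD_real V) (dW S) (dW_real S)) h Φ) =
          adelicSchrodinger (↥(NumberField.maximalRealSubfield (L : Type))) (Fin 3 × Fin (1 + 1))
              (cmProdGram (L : Type) (frameD V) (frameD_real V) (dW S) (dW_real S))
            ((ofSymplectic (polar (adelicForm (↥(NumberField.maximalRealSubfield (L : Type))) (Fin 3 × Fin (1 + 1))
                (cmProdGram (L : Type) (frameD V) (frameD_real V) (dW S) (dW_real S))))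
              (adelicMpCont.proj (↥(NumberField.maximalRealSubfield (L : Type))) (Fin 3 × Fin (1 + 1))
                (cmProdGram (L : Type) (frameD V) (frameD_real V) (dW S) (dW_real S))
                (cmConjSeesawMp (L : Type) (frameD V) (frameD_real V) (frameD_ne V) (dW S) (dW_real S) (dW_ne S)
                  (dW' S) (dW'_real S) (dW'_ne S) S.isoGL (isoGL_hg₀ S)))).act h)
            (adelicTensorEnd LinearMap.id (Mf : _ →ₗ[ℂ] _) Φ)) ∧
      (∀ (Φ : 𝓢((Fin 3 × Fin (1 + 1) → mixedSpace (↥(NumberField.maximalRealSubfield (L : Type)))), ℂ))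
          (f : FinSB (↥(NumberField.maximalRealSubfield (L : Type))) (Fin 3 × Fin (1 + 1))),
        adelicMpCont.omega (↥(NumberField.maximalRealSubfield (L : Type))) (Fin 3 × Fin (1 + 1))
            (cmProdGram (L : Type) (frameD V) (frameD_real V) (dW S) (dW_real S))
            (cmConjSeesawMp (L : Type) (frameD V) (frameD_real V) (frameD_ne V) (dW S) (dW_real S) (dW_ne S)
              (dW' S) (dW'_real S) (dW'_ne S) S.isoGL (isoGL_hg₀ S))
            (piSchwartzBruhatEquiv (↥(NumberField.maximalRealSubfield (L : Type))) (Fin 3 × Fin (1 + 1)) (Φ ⊗ₜ f)) =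
          piSchwartzBruhatEquiv (↥(NumberField.maximalRealSubfield (L : Type))) (Fin 3 × Fin (1 + 1)) (A Φ ⊗ₜ Mf f)) ∧
      ∀ (Φ₀ Φ₁ : 𝓢((Fin 3 → mixedSpace (↥(NumberField.maximalRealSubfield (L : Type)))), ℂ)) (f₀ f₁ : FinSB (↥(NumberField.maximalRealSubfield (L : Type))) (Fin 3)),
        cmConjLineTensorFin (L : Type) finProdFinEquiv e₁ (frameD V) (frameD_real V) (frameD_ne V) (dW S) (dW_real S) (dW_ne S)
            (dW' S) (dW'_real S) (dW'_ne S) S.isoGL (isoGL_hg₀ S)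
            (piSchwartzBruhatEquiv (↥(NumberField.maximalRealSubfield (L : Type))) (Fin 3) (Φ₀ ⊗ₜ f₀))
            (piSchwartzBruhatEquiv (↥(NumberField.maximalRealSubfield (L : Type))) (Fin 3) (Φ₁ ⊗ₜ f₁)) =
          piSchwartzBruhatEquiv (↥(NumberField.maximalRealSubfield (L : Type))) (Fin (3 * 2))
            (schwartzReindexCLM (↥(NumberField.maximalRealSubfield (L : Type))) finProdFinEquiv (A (conjSlotRawBox (L := L) Φ₀ Φ₁)) ⊗ₜ
              finSBReindex (↥(NumberField.maximalRealSubfield (L : Type))) finProdFinEquiv (Mf (conjSlotRawFin (L := L) f₀ f₁))) := by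
  -- `have` first: `obtain … := <term>` would `generalize` the term over the goal, i.e. re-typecheck the whole statement
  have h := exists_omega_map_tmul_of_isUnit_det
    (isUnit_det_cmProdGram (L : Type) (frameD V) (frameD_real V) (frameD_ne V) (dW S) (dW_real S) (dW_ne S))
    (cmConjSeesawMp (L : Type) (frameD V) (frameD_real V) (frameD_ne V) (dW S) (dW_real S) (dW_ne S)
      (dW' S) (dW'_real S) (dW'_ne S) S.isoGL (isoGL_hg₀ S))
  obtain ⟨A, Mf, hMf, hAM⟩ := h
  refine ⟨A, Mf, hMf, hAM, fun Φ₀ Φ₁ f₀ f₁ => ?_⟩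
  -- (a) the two slots: `R_{e₁}⁻¹ (Φᵢ ⊗ fᵢ) ⊠` as ONE pure tensor (a small goal — `rw` is cheap here)
  have hg : tensorToSum (↥(NumberField.maximalRealSubfield (L : Type))) (Fin 3 × Fin 1) (Fin 3 × Fin 1)
        ((piSBReindex (↥(NumberField.maximalRealSubfield (L : Type))) e₁).symm (piSchwartzBruhatEquiv (↥(NumberField.maximalRealSubfield (L : Type))) (Fin 3) (Φ₀ ⊗ₜ f₀)))
        ((piSBReindex (↥(NumberField.maximalRealSubfield (L : Type))) e₁).symm (piSchwartzBruhatEquiv (↥(NumberField.maximalRealSubfield (L : Type))) (Fin 3) (Φ₁ ⊗ₜ f₁))) =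
      piSchwartzBruhatEquiv (↥(NumberField.maximalRealSubfield (L : Type))) ((Fin 3 × Fin 1) ⊕ (Fin 3 × Fin 1))
        (archBoxTensor (schwartzReindexCLM (↥(NumberField.maximalRealSubfield (L : Type))) e₁.symm Φ₀) (schwartzReindexCLM (↥(NumberField.maximalRealSubfield (L : Type))) e₁.symm Φ₁) ⊗ₜ
          finSumEquiv (↥(NumberField.maximalRealSubfield (L : Type))) (Fin 3 × Fin 1) (Fin 3 × Fin 1)
            (finSBReindex (↥(NumberField.maximalRealSubfield (L : Type))) e₁.symm f₀ ⊗ₜ finSBReindex (↥(NumberField.maximalRealSubfield (L : Type))) e₁.symm f₁)) := by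
    rw [piSBReindex_symm, piSBReindex_tmul, piSBReindex_tmul, tensorToSum_tmul]
  -- (b) push the pure tensor through `R_f⁻¹`, `ω(r_F h₀) = A_∞ ⊗ M_f` (STRIP) and `R_e`; by congruence, never by `rw` on the
  -- goal (a goal carrying `r_F h₀` makes `rw`'s `kabstract` refute dozens of look-alike subterms by deep unfolding)
  refine (cmConjLineTensorFin_eq_reindex_omega (L : Type) finProdFinEquiv e₁ (frameD V) (frameD_real V) (frameD_ne V) (dW S)
    (dW_real S) (dW_ne S) (dW' S) (dW'_real S) (dW'_ne S) S.isoGL (isoGL_hg₀ S) _ _).trans ?_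
  refine (congrArg (fun z => piSBReindex (↥(NumberField.maximalRealSubfield (L : Type))) finProdFinEquiv
    (adelicMpCont.omega (↥(NumberField.maximalRealSubfield (L : Type))) (Fin 3 × Fin (1 + 1)) (cmProdGram (L : Type) (frameD V) (frameD_real V) (dW S) (dW_real S))
      (cmConjSeesawMp (L : Type) (frameD V) (frameD_real V) (frameD_ne V) (dW S) (dW_real S) (dW_ne S)
        (dW' S) (dW'_real S) (dW'_ne S) S.isoGL (isoGL_hg₀ S))
      ((piSBReindex (↥(NumberField.maximalRealSubfield (L : Type))) (finProdSumEquiv 3 1 1)).symm z))) hg).trans ?_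
  refine (congrArg (fun z => piSBReindex (↥(NumberField.maximalRealSubfield (L : Type))) finProdFinEquiv
    (adelicMpCont.omega (↥(NumberField.maximalRealSubfield (L : Type))) (Fin 3 × Fin (1 + 1)) (cmProdGram (L : Type) (frameD V) (frameD_real V) (dW S) (dW_real S))
      (cmConjSeesawMp (L : Type) (frameD V) (frameD_real V) (frameD_ne V) (dW S) (dW_real S) (dW_ne S)
        (dW' S) (dW'_real S) (dW'_ne S) S.isoGL (isoGL_hg₀ S)) z))
    ((DFunLike.congr_fun (piSBReindex_symm (↥(NumberField.maximalRealSubfield (L : Type))) (finProdSumEquiv 3 1 1)) _).trans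
      (piSBReindex_tmul (↥(NumberField.maximalRealSubfield (L : Type))) (finProdSumEquiv 3 1 1).symm
        (archBoxTensor (schwartzReindexCLM (↥(NumberField.maximalRealSubfield (L : Type))) e₁.symm Φ₀) (schwartzReindexCLM (↥(NumberField.maximalRealSubfield (L : Type))) e₁.symm Φ₁)) _))).trans ?_
  exact (congrArg (piSBReindex (↥(NumberField.maximalRealSubfield (L : Type))) finProdFinEquiv)
    (hAM (conjSlotRawBox (L := L) Φ₀ Φ₁) (conjSlotRawFin (L := L) f₀ f₁))).trans
    (piSBReindex_tmul (↥(NumberField.maximalRealSubfield (L : Type))) finProdFinEquiv _ _)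

/-- **(STRIP) FOR THE CONJUGATED PLANE, test-function form** (the socket's `hstrip` of `slotTypeVec_sub_eq_of_conj_transport`):
with `A_∞`, `M_f` as above, the conjugated see-saw tensor of ANY two thin-coset test functions of the same level is the pure tensor
`E (Y ⊗ F)` with `Y = R_e^∞ (A_∞ (conjSlotRawBox Φ₀ Φ₁))`. -/
theorem exists_cmConjLineTensorFin_testFun_eq_tmul :
    ∃ (A : 𝓢((Fin 3 × Fin (1 + 1) → mixedSpace (↥(NumberField.maximalRealSubfield (L : Type)))), ℂ) ≃L[ℂ]
        𝓢((Fin 3 × Fin (1 + 1) → mixedSpace (↥(NumberField.maximalRealSubfield (L : Type)))), ℂ))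
      (Mf : FinSB (↥(NumberField.maximalRealSubfield (L : Type))) (Fin 3 × Fin (1 + 1)) ≃ₗ[ℂ]
        FinSB (↥(NumberField.maximalRealSubfield (L : Type))) (Fin 3 × Fin (1 + 1))),
      (∀ h ∈ finHeisenberg (cmProdGram (L : Type) (frameD V) (frameD_real V) (dW S) (dW_real S)),
        ∀ Φ : piSchwartzBruhat (↥(NumberField.maximalRealSubfield (L : Type))) (Fin 3 × Fin (1 + 1)),
        adelicTensorEnd LinearMap.id (Mf : _ →ₗ[ℂ] _)
            (adelicSchrodinger (↥(NumberField.maximalRealSubfield (L : Type))) (Fin 3 × Fin (1 + 1))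
              (cmProdGram (L : Type) (frameD V) (frameD_real V) (dW S) (dW_real S)) h Φ) =
          adelicSchrodinger (↥(NumberField.maximalRealSubfield (L : Type))) (Fin 3 × Fin (1 + 1))
              (cmProdGram (L : Type) (frameD V) (frameD_real V) (dW S) (dW_real S))
            ((ofSymplectic (polar (adelicForm (↥(NumberField.maximalRealSubfield (L : Type))) (Fin 3 × Fin (1 + 1))
                (cmProdGram (L : Type) (frameD V) (frameD_real V) (dW S) (dW_real S))))
              (adelicMpCont.proj (↥(NumberField.maximalRealSubfield (L : Type))) (Fin 3 × Fin (1 + 1))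
                (cmProdGram (L : Type) (frameD V) (frameD_real V) (dW S) (dW_real S))
                (cmConjSeesawMp (L : Type) (frameD V) (frameD_real V) (frameD_ne V) (dW S) (dW_real S) (dW_ne S)
                  (dW' S) (dW'_real S) (dW'_ne S) S.isoGL (isoGL_hg₀ S)))).act h)
            (adelicTensorEnd LinearMap.id (Mf : _ →ₗ[ℂ] _) Φ)) ∧
      (∀ (Φ : 𝓢((Fin 3 × Fin (1 + 1) → mixedSpace (↥(NumberField.maximalRealSubfield (L : Type)))), ℂ))
          (f : FinSB (↥(NumberField.maximalRealSubfield (L : Type))) (Fin 3 × Fin (1 + 1))),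
        adelicMpCont.omega (↥(NumberField.maximalRealSubfield (L : Type))) (Fin 3 × Fin (1 + 1))
            (cmProdGram (L : Type) (frameD V) (frameD_real V) (dW S) (dW_real S))
            (cmConjSeesawMp (L : Type) (frameD V) (frameD_real V) (frameD_ne V) (dW S) (dW_real S) (dW_ne S)
              (dW' S) (dW'_real S) (dW'_ne S) S.isoGL (isoGL_hg₀ S))
            (piSchwartzBruhatEquiv (↥(NumberField.maximalRealSubfield (L : Type))) (Fin 3 × Fin (1 + 1)) (Φ ⊗ₜ f)) =
          piSchwartzBruhatEquiv (↥(NumberField.maximalRealSubfield (L : Type))) (Fin 3 × Fin (1 + 1)) (A Φ ⊗ₜ Mf f)) ∧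
      ∀ (Φ₀ Φ₁ : 𝓢((Fin 3 → mixedSpace (↥(NumberField.maximalRealSubfield (L : Type)))), ℂ))
        (x₀ x₁ : Fin 3 → (↥(NumberField.maximalRealSubfield (L : Type)))) (N : ℕ),
        ∃ f : FinSB (↥(NumberField.maximalRealSubfield (L : Type))) (Fin (3 * 2)),
          cmConjLineTensorFin (L : Type) finProdFinEquiv e₁ (frameD V) (frameD_real V) (frameD_ne V) (dW S) (dW_real S) (dW_ne S)
              (dW' S) (dW'_real S) (dW'_ne S) S.isoGL (isoGL_hg₀ S)
              (SupplyInstance.testFun (↥(NumberField.maximalRealSubfield (L : Type))) (Fin 3) Φ₀ x₀ N)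
              (SupplyInstance.testFun (↥(NumberField.maximalRealSubfield (L : Type))) (Fin 3) Φ₁ x₁ N) =
            piSchwartzBruhatEquiv (↥(NumberField.maximalRealSubfield (L : Type))) (Fin (3 * 2))
              (schwartzReindexCLM (↥(NumberField.maximalRealSubfield (L : Type))) finProdFinEquiv (A (conjSlotRawBox (L := L) Φ₀ Φ₁)) ⊗ₜ f) := by
  have h := exists_cmConjLineTensorFin_tmul_eq_tmul V S
  obtain ⟨A, Mf, hMf, hAM, htens⟩ := h
  refine ⟨A, Mf, hMf, hAM, fun Φ₀ Φ₁ x₀ x₁ N => ?_⟩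
  -- `φ_N(Ψ) = E(Ψ ⊗ (translated level indicator))`, definitionally a thin-coset test function
  have ht : ∀ (Ψ : 𝓢((Fin 3 → mixedSpace (↥(NumberField.maximalRealSubfield (L : Type)))), ℂ)) (x : Fin 3 → (↥(NumberField.maximalRealSubfield (L : Type)))),
      SupplyInstance.testFun (↥(NumberField.maximalRealSubfield (L : Type))) (Fin 3) Ψ x N = _ := fun Ψ x =>
    (rfl : SupplyInstance.testFun (↥(NumberField.maximalRealSubfield (L : Type))) (Fin 3) Ψ x N =
      thinCosetTestFunₗ (K := (↥(NumberField.maximalRealSubfield (L : Type)))) (ι := Fin 3) (SupplyInstance.finEmb (↥(NumberField.maximalRealSubfield (L : Type))) (Fin 3) x)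
        (Ideal.span {((N : ℕ) : NumberField.RingOfIntegers (↥(NumberField.maximalRealSubfield (L : Type))))}) Ψ).trans (thinCosetTestFunₗ_eq_tmul _ _ _)
  exact ⟨_, (congrArg₂ (fun u v => cmConjLineTensorFin (L : Type) finProdFinEquiv e₁ (frameD V) (frameD_real V) (frameD_ne V)
    (dW S) (dW_real S) (dW_ne S) (dW' S) (dW'_real S) (dW'_ne S) S.isoGL (isoGL_hg₀ S) u v) (ht Φ₀ x₀) (ht Φ₁ x₁)).trans
    (htens Φ₀ Φ₁ _ _)⟩


end Datum

end HodgeCM.Model.ArchSideTerm
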